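import Literature.AlgebraicGeometry.Motives.AbelianSchemeModelTateSpecialisationFamily
import HarnessLib

/-!
# The reduction map of an ARBITRARY good-reduction datum and its naturality under ANY reduction-of-homomorphisms datum
# — [Serre–Tate 1968, §1; Shimura 1998, §11.1 Prop. 12 / Prop. 14 (i)]

Topic `Literature/AlgebraicGeometry/Motives`; namespace `Literature.AlgebraicGeometry.Motives.AbelianVariety.GoodReductionAt`.
Choice-free definitions + theorems; NO named fact, no instance, no notation (net Literature debt 0).  Cell `hodgecm-mathlib`
(D-0151), row II-1, edition E4 «S5c′ ↦ Q5», background piece (A) of B-p15's Q5 road (SCOPE-E4-Q5 memo, road B).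

WHAT IS HERE.  For an abelian variety `B` over a number field `K` and ANY good-reduction datum
`S : B.GoodReductionAt v` (model `𝒳 = S.model.total` over `𝓞_{K,v}` with ITS OWN generic isomorphism
`S.model.genericIso : 𝒳_K ≅ B` and ITS OWN reduction isomorphism `S.reductionIso : S.reduction ≅ 𝒳_v` — both DATA,
no `Exists.choose`):

* `GoodReductionAt.modelPointsEquiv S : Hom_{𝓞ᵥ}(Spec Ω, 𝒳) ≃ B(Ω)` (`Ω = K̄ᵥ`; adjunction `Over.map ⊣ Over.pullback`
  and `S.model.genericIso`), `GoodReductionAt.reductionPoint S : 𝒳(κ(R)) → S.reduction(κ̄(v))` (adjunction and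
  `S.reductionIso⁻¹`), and **`GoodReductionAt.geomReductionMap S : B(K̄) → S.reduction(κ̄(v))`**, the reduction map
  `B(K̄) → B(K̄ᵥ) ≃ 𝒳(Ω) →[valuative criterion] 𝒳(R) → 𝒳(κ(R)) ≃ S.reduction(κ̄(v))` ([SerreTate1968] §1);
* **`IsAbelianSchemeModel.geomReductionMap_goodReductionAt`** — for the PRODUCED datum of an abelian-scheme model
  (`h.goodReductionAt`, [p617360]) this is the tree's `red_v = h.specialFibreReductionHom` on the nose;
* **`GoodReductionAt.HomReduction.geomReductionMap_geomPointsMap`** — for ANY reduction-of-homomorphisms datum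
  `H : HomReduction R S` between ANY two good-reduction data and every `f : A → B`,
  `red_S (f x) = (H.redHom f) (red_R x)` ([Shimura1998] §11.1 Prop. 12 «the reduction `λ̃` of `λ`»; the torsion-level
  content of Prop. 14 (i) «`M_l(λ) = M_l(λ̃)`»): `H.liftHom_left_comp` pins the generic fibre of `H.liftHom f`,
  uniqueness in the valuative criterion makes extension natural (`extendPoint_comp_hom`), and `H.redHom_left_comp` pins
  the special fibre.  This is T6 (`IsAbelianSchemeModel.specialFibreReductionHom_geomPointsMap`) at the level of
  ABSTRACT data — the form needed when one side is the Frobenius-conjugate datum `R.conjFrob …` (whose model and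
  isomorphisms are explicit, [Shimura1998] §18.6 p. 129 «`(Y^σ)~ = Ỹ^f`»), where no `IsAbelianSchemeModel` with a
  controllable generic isomorphism is available (the «rigidification seam»).

HC_CM is proved only modulo the 7 printed citations until rung 0 closes.

## References
* [SerreTate1968] J.-P. Serre, J. Tate, *Good reduction of abelian varieties*, Ann. of Math. 88 (1968), §1 (the
  reduction map; Lemma 2).
* [Shimura1998] G. Shimura, *Abelian Varieties with Complex Multiplication and Modular Functions*, Princeton 1998,
  §11.1 Prop. 12 and Prop. 14 (i) (pp. 83–87); §18.6 (p. 129).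
* [Hartshorne1977] R. Hartshorne, *Algebraic Geometry*, II.4.7 (valuative criterion), II.3 (fibre products).
-/

set_option autoImplicit false

noncomputable section

open CategoryTheory AlgebraicGeometry IsDedekindDomain IsDedekindDomain.HeightOneSpectrum
open scoped NumberField
open Literature.NumberTheory.EllipticCurves (genericFibre specGenericPoint)
open Literature.NumberTheory.GaloisRepresentations (closureValuationSubring)
open Literature.NumberTheory.DiophantineGeometry

namespace Literature.AlgebraicGeometry.Motives

namespace AbelianVariety

namespace GoodReductionAt

variable {K : Type} [Field K] [NumberField K] {v : HeightOneSpectrum (𝓞 K)} {A B : AbelianVariety K}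

/-! ### The layers of the reduction map of a good-reduction datum -/

/-- The model of a good-reduction datum is proper over `𝓞_{K,v}` (field `isSmoothProper`). [cite: SerreTate1968, §1] -/
theorem isProper_model (S : B.GoodReductionAt v) : IsProper S.model.total.hom := S.isSmoothProper.2

/-- The generic isomorphism of the datum, RETYPED at the generic-fibre functor: `𝒳 ×_{𝓞ᵥ} K ≅ B`
(`Motives.baseChange 𝓞ᵥ K` is `genericFibre 𝓞ᵥ K` by `rfl`; the retyping keeps composites with the adjunction
`Over.mapPullbackAdj (specGenericPoint 𝓞ᵥ K)` type-correct at reducible transparency). [cite: SerreTate1968, §1] -/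
def genericIso' (S : B.GoodReductionAt v) :
    (genericFibre (valuationSubringAtPrime K v) K).obj S.model.total ≅ B.X :=
  S.model.genericIso

/-- **`Hom_{𝓞_{K,v}}(Spec Ω, 𝒳) ≃ B(Ω)`** (`Ω = K̄ᵥ`) for the model `𝒳` of a good-reduction datum `S` of `B`: an
`Ω`-point of `𝒳` over `𝓞_{K,v}` is an `Ω`-point of the generic fibre `𝒳_K` (adjunction `Over.map ⊣ Over.pullback`),
read in `B` through the datum's OWN generic isomorphism `S.model.genericIso` (universal property of the fibre product).
[cite: Hartshorne1977, II.3 Thm. 3.3 (fibre product, universal property)] -/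
def modelPointsEquiv (S : B.GoodReductionAt v) :
    (specFractionField (closureValuationSubring (v.adicCompletion K)) (toClosureValuationSubring v) ⟶ S.model.total) ≃
      B.Points (AlgebraicClosure (v.adicCompletion K)) :=
  ((specFractionFieldIso v).homCongr (Iso.refl S.model.total)).trans
    (((Over.mapPullbackAdj (specGenericPoint (valuationSubringAtPrime K v) K)).homEquiv _ S.model.total).trans
      ((Iso.refl _).homCongr S.genericIso'))

/-- Unfolding `modelPointsEquiv`: adjoint of `e⁻¹ ≫ P`, followed by `S.model.genericIso`.
[cite: Hartshorne1977, II.3 Thm. 3.3 (fibre product, universal property)] -/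
theorem modelPointsEquiv_apply (S : B.GoodReductionAt v)
    (P : specFractionField (closureValuationSubring (v.adicCompletion K)) (toClosureValuationSubring v) ⟶ S.model.total) :
    S.modelPointsEquiv P =
      (Over.mapPullbackAdj (specGenericPoint (valuationSubringAtPrime K v) K)).homEquiv _ S.model.total
          ((specFractionFieldIso v).inv ≫ P) ≫ S.genericIso'.hom := by
  change (Iso.refl _).inv ≫ (Over.mapPullbackAdj (specGenericPoint (valuationSubringAtPrime K v) K)).homEquiv _
    S.model.total ((specFractionFieldIso v).inv ≫ P ≫ (Iso.refl S.model.total).hom) ≫ S.genericIso'.hom = _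
  rw [Iso.refl_hom, Iso.refl_inv, Category.comp_id, Category.id_comp]

/-- The reduction isomorphism of the datum, RETYPED at the special-fibre functor: `S.reduction.X ≅ 𝒳 ×_{𝓞ᵥ} κ(v)`
(`IntegralModel.reductionAt` is `(specialFibreFunctor v).obj _` by `rfl`; the retyping keeps composites with
`(specialFibreFunctor v).map _` type-correct at reducible transparency). [cite: SerreTate1968, §1] -/
def reductionIso' (S : B.GoodReductionAt v) : S.reduction.X ≅ (specialFibreFunctor v).obj S.model.total :=
  S.reductionIso

/-- **`𝒳(κ(R)) → S.reduction(κ̄(v))`**: a `κ(R)`-point of the model (`κ(R)` the residue field of `R ⊆ K̄ᵥ`, re-based to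
the abstract `κ̄(v)` along `geomClosedPointIsoSpecResidueField`) is a `κ̄(v)`-point of the special fibre `𝒳_v`
(adjunction), read in the abelian variety `S.reduction` through the datum's OWN `S.reductionIso⁻¹`.
[cite: Hartshorne1977, II.3 Thm. 3.3 (fibre product, universal property)] -/
def reductionPoint (S : B.GoodReductionAt v) (y : residueFieldPoints S.model.total) :
    S.reduction.Points (geomResidueField v) :=
  (Over.mapPullbackAdj (specResidueField v)).homEquiv _ S.model.total
      ((geomClosedPointIso v).inv ≫ (geomClosedPointIsoSpecResidueField v).inv ≫ y) ≫ S.reductionIso'.inv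

/-- **The reduction map `red_S : B(K̄) → S.reduction(κ̄(v))` of a good-reduction datum** ([SerreTate1968] §1 «the
reduction map»): `B(K̄) → B(K̄ᵥ) ≃ 𝒳(Ω)` (`modelPointsEquiv⁻¹`), extension to an `R`-point by the valuative
criterion of properness (`extendPoint`), specialisation to `κ(R)`, and `reductionPoint`.  A plain function (no group
structure on the model is assumed). [cite: SerreTate1968, §1] [cite: Hartshorne1977, II.4.7] -/
def geomReductionMap (S : B.GoodReductionAt v) (x : B.geomPoints) : S.reduction.geomPoints :=
  haveI := S.isProper_model
  Additive.ofMul (S.reductionPoint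
    (specRingHomι (closureValuationSubring (v.adicCompletion K)) (toClosureValuationSubring v)
        (IsLocalRing.residue (closureValuationSubring (v.adicCompletion K))) ≫
      extendPoint (closureValuationSubring (v.adicCompletion K)) (toClosureValuationSubring v) S.model.total
        (S.modelPointsEquiv.symm (toAdicCompletionPoints B v (Additive.toMul x)))))

/-- Unfolding `geomReductionMap`. [cite: SerreTate1968, §1] -/
theorem toMul_geomReductionMap (S : B.GoodReductionAt v) (x : B.geomPoints) :
    Additive.toMul (S.geomReductionMap x) =
      haveI := S.isProper_model
      S.reductionPoint
        (specRingHomι (closureValuationSubring (v.adicCompletion K)) (toClosureValuationSubring v)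
            (IsLocalRing.residue (closureValuationSubring (v.adicCompletion K))) ≫
          extendPoint (closureValuationSubring (v.adicCompletion K)) (toClosureValuationSubring v) S.model.total
            (S.modelPointsEquiv.symm (toAdicCompletionPoints B v (Additive.toMul x)))) :=
  rfl

/-! ### Naturality of the layers under a reduction-of-homomorphisms datum -/

namespace HomReduction

variable {R : A.GoodReductionAt v} {S : B.GoodReductionAt v}

/-- The generic-fibre square of `H.liftHom f`, as an equation of `K`-morphisms:
`(liftHom f)_K ≫ e_S = e_R ≫ f`. [cite: BombieriGubler2006, 10.3.9 (p. 334)] -/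
@[reassoc]
theorem map_liftHom_comp_genericIso'_hom (H : HomReduction R S) (f : A ⟶ B) :
    (genericFibre (valuationSubringAtPrime K v) K).map (H.liftHom f) ≫ S.genericIso'.hom =
      R.genericIso'.hom ≫ f.hom.hom.hom :=
  Over.OverMorphism.ext (H.liftHom_left_comp f)

/-- The special-fibre square of `H.liftHom f`, as an equation of `κ(v)`-morphisms:
`redHom f ≫ S.reductionIso = R.reductionIso ≫ (liftHom f)_v`. [cite: Shimura1998, §11.1 Prop. 12] -/
@[reassoc]
theorem redHom_comp_reductionIso'_hom (H : HomReduction R S) (f : A ⟶ B) :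
    (H.redHom f).hom.hom.hom ≫ S.reductionIso'.hom = R.reductionIso'.hom ≫ (specialFibreFunctor v).map (H.liftHom f) :=
  Over.OverMorphism.ext (H.redHom_left_comp f)

/-- The special-fibre square with the inverses: `(liftHom f)_v ≫ S.reductionIso⁻¹ = R.reductionIso⁻¹ ≫ redHom f`.
[cite: Shimura1998, §11.1 Prop. 12] -/
@[reassoc]
theorem map_liftHom_comp_reductionIso'_inv (H : HomReduction R S) (f : A ⟶ B) :
    (specialFibreFunctor v).map (H.liftHom f) ≫ S.reductionIso'.inv = R.reductionIso'.inv ≫ (H.redHom f).hom.hom.hom := by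
  rw [Iso.comp_inv_eq, Category.assoc, Iso.eq_inv_comp, H.redHom_comp_reductionIso'_hom]

/-- **`modelPointsEquiv` is natural**: `e_S (P ≫ liftHom f) = e_R(P) ≫ f` (adjunction naturality and the generic-fibre
square of `H`). [cite: Hartshorne1977, II.3 Thm. 3.3 (fibre product, universal property)] -/
theorem modelPointsEquiv_comp_liftHom (H : HomReduction R S) (f : A ⟶ B)
    (P : specFractionField (closureValuationSubring (v.adicCompletion K)) (toClosureValuationSubring v) ⟶ R.model.total) :
    S.modelPointsEquiv (P ≫ H.liftHom f) = AlgPoints.map f.hom.hom.hom (R.modelPointsEquiv P) := by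
  rw [S.modelPointsEquiv_apply, R.modelPointsEquiv_apply, AlgPoints.map_apply,
    ← Category.assoc (specFractionFieldIso v).inv P (H.liftHom f), Adjunction.homEquiv_naturality_right,
    Category.assoc, Category.assoc]
  congr 1
  exact H.map_liftHom_comp_genericIso'_hom f

/-- The inverse form: `e_S⁻¹ (Q ≫ f) = e_R⁻¹(Q) ≫ liftHom f`. [cite: Hartshorne1977, II.3 Thm. 3.3 (fibre product, universal property)] -/
theorem modelPointsEquiv_symm_map (H : HomReduction R S) (f : A ⟶ B)
    (Q : A.Points (AlgebraicClosure (v.adicCompletion K))) :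
    S.modelPointsEquiv.symm (AlgPoints.map f.hom.hom.hom Q) = R.modelPointsEquiv.symm Q ≫ H.liftHom f := by
  apply S.modelPointsEquiv.injective
  rw [Equiv.apply_symm_apply, H.modelPointsEquiv_comp_liftHom f, Equiv.apply_symm_apply]

/-- **`reductionPoint` is natural**: `r_S (y ≫ liftHom f) = r_R(y) ≫ redHom f` (adjunction naturality and the
special-fibre square of `H`). [cite: Hartshorne1977, II.3 Thm. 3.3 (fibre product, universal property)] -/
theorem reductionPoint_comp_liftHom (H : HomReduction R S) (f : A ⟶ B) (y : residueFieldPoints R.model.total) :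
    S.reductionPoint (y ≫ H.liftHom f) = AlgPoints.map (H.redHom f).hom.hom.hom (R.reductionPoint y) := by
  rw [reductionPoint, reductionPoint, AlgPoints.map_apply, ← Category.assoc (geomClosedPointIsoSpecResidueField v).inv,
    ← Category.assoc (geomClosedPointIso v).inv, Adjunction.homEquiv_naturality_right, Category.assoc, Category.assoc]
  congr 1
  exact H.map_liftHom_comp_reductionIso'_inv f

/-- **The reduction map commutes with homomorphisms and their reductions, for ANY data** ([SerreTate1968] §1: the
reduction map is functorial; [Shimura1998] §11.1 Prop. 12 «the reduction `λ̃` of `λ`», and the torsion-level content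
of Prop. 14 (i) «`M_l(λ) = M_l(λ̃)`»): for good-reduction data `R` of `A` and `S` of `B` at `v`, ANY
reduction-of-homomorphisms datum `H : HomReduction R S` and every `f : A → B`,
`red_S (f x) = (H.redHom f) (red_R x)` for every geometric point `x ∈ A(K̄)`.  (`H.liftHom_left_comp` pins the generic
fibre of `H.liftHom f`; extensions along the valuative criterion are unique, hence natural; `H.redHom_left_comp` pins
the special fibre.) [cite: SerreTate1968, §1] [cite: Shimura1998, §11.1 Prop. 12 and Prop. 14 (i)] -/
theorem geomReductionMap_geomPointsMap (H : HomReduction R S) (f : A ⟶ B) (x : A.geomPoints) :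
    S.geomReductionMap (Hom.geomPointsMap f x) = Hom.geomPointsMap (H.redHom f) (R.geomReductionMap x) := by
  haveI := R.isProper_model
  haveI := S.isProper_model
  apply Additive.toMul.injective
  rw [toMul_geomReductionMap, Hom.geomPointsMap_apply, Hom.geomPointsMap_apply, toMul_geomReductionMap,
    toAdicCompletionPoints_map, H.modelPointsEquiv_symm_map f, extendPoint_comp_hom, ← Category.assoc,
    H.reductionPoint_comp_liftHom f]

end HomReduction

end GoodReductionAt

end AbelianVariety

end Literature.AlgebraicGeometry.Motives

/-! ### The produced datum of an abelian-scheme model: `geomReductionMap = red_v` -/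

namespace Literature.NumberTheory.DiophantineGeometry

namespace IsAbelianSchemeModel

open Literature.AlgebraicGeometry.Motives Literature.AlgebraicGeometry.Motives.AbelianVariety
open Literature.NumberTheory.GaloisRepresentations (closureValuationSubring)
open scoped MonObj CategoryTheory.Obj

variable {K : Type} [Field K] [NumberField K] {v : HeightOneSpectrum (𝓞 K)} {A B : AbelianVariety K}
  {𝒜 : SchemeOver (valuationSubringAtPrime K v)} [GrpObj 𝒜]

/-- For the produced datum, `modelPointsEquiv` is the tree's `fractionFieldPointsEquiv` (same formula; the produced
datum's generic isomorphism IS `h.exists_iso.choose`). [cite: Hartshorne1977, II.3 Thm. 3.3 (fibre product, universal property)] -/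
theorem modelPointsEquiv_goodReductionAt (h : IsAbelianSchemeModel B v 𝒜)
    (P : specFractionField (closureValuationSubring (v.adicCompletion K)) (toClosureValuationSubring v) ⟶ 𝒜) :
    h.goodReductionAt.modelPointsEquiv P = h.fractionFieldPointsEquiv P := by
  rw [GoodReductionAt.modelPointsEquiv_apply, h.fractionFieldPointsEquiv_apply]
  rfl

/-- The inverse form. [cite: Hartshorne1977, II.3 Thm. 3.3 (fibre product, universal property)] -/
theorem modelPointsEquiv_symm_goodReductionAt (h : IsAbelianSchemeModel B v 𝒜)
    (Q : B.Points (AlgebraicClosure (v.adicCompletion K))) :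
    h.goodReductionAt.modelPointsEquiv.symm Q = h.fractionFieldPointsEquiv.symm Q := by
  apply h.goodReductionAt.modelPointsEquiv.injective
  rw [Equiv.apply_symm_apply, modelPointsEquiv_goodReductionAt, MulEquiv.apply_symm_apply]

/-- For the produced datum (`reductionIso = Iso.refl`), `reductionPoint` is the tree's
`additiveResidueFieldPointsEquiv` (re-basing `κ(R) ≅ κ̄(v)` then the adjunction). [cite: Hartshorne1977, II.3 Thm. 3.3 (fibre product, universal property)] -/
theorem reductionPoint_goodReductionAt (h : IsAbelianSchemeModel B v 𝒜) (y : residueFieldPoints 𝒜) :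
    Additive.ofMul (h.goodReductionAt.reductionPoint y) = h.additiveResidueFieldPointsEquiv (Additive.ofMul y) := by
  apply Additive.toMul.injective
  change h.goodReductionAt.reductionPoint y = h.specialFibrePointsEquiv (residueFieldPointsEquiv v 𝒜 y)
  rw [h.specialFibrePointsEquiv_apply]
  change (Over.mapPullbackAdj (specResidueField v)).homEquiv _ 𝒜
      ((geomClosedPointIso v).inv ≫ (geomClosedPointIsoSpecResidueField v).inv ≫ y) ≫ 𝟙 _ =
    (Over.mapPullbackAdj (specResidueField v)).homEquiv _ 𝒜
      ((geomClosedPointIso v).inv ≫ (geomClosedPointIsoSpecResidueField v).inv ≫ y ≫ (Iso.refl 𝒜).hom)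
  rw [Iso.refl_hom, Category.comp_id, Category.comp_id]

/-- **For the produced datum of an abelian-scheme model, `geomReductionMap` IS the tree's reduction map
`red_v = h.specialFibreReductionHom`** (all layers agree: `modelPointsEquiv_goodReductionAt`,
`reductionPoint_goodReductionAt`). [cite: SerreTate1968, §1] -/
theorem geomReductionMap_goodReductionAt (h : IsAbelianSchemeModel B v 𝒜) (x : B.geomPoints) :
    h.goodReductionAt.geomReductionMap x = h.specialFibreReductionHom x := by
  haveI := h.isProper
  rw [h.specialFibreReductionHom_apply, h.geomReductionHom_apply, h.reductionHom_apply,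
    Literature.AlgebraicGeometry.Motives.reducePointMonoidHom_apply, ← reductionPoint_goodReductionAt,
    ← modelPointsEquiv_symm_goodReductionAt]
  rfl

/-- As functions: `h.goodReductionAt.geomReductionMap = ⇑h.specialFibreReductionHom`. [cite: SerreTate1968, §1] -/
theorem geomReductionMap_goodReductionAt_eq (h : IsAbelianSchemeModel B v 𝒜) :
    h.goodReductionAt.geomReductionMap = ⇑h.specialFibreReductionHom :=
  funext h.geomReductionMap_goodReductionAt

/-- **Any reduction-of-homomorphisms datum out of a produced datum has the reduction map of its target pinned on the
image of `A(K̄)`**: for `H : HomReduction h.goodReductionAt S` (ANY target datum `S` of `B`, e.g. a Frobenius-conjugate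
datum `R.conjFrob …`), `red_S (f x) = (H.redHom f) (red_v x)`. [cite: Shimura1998, §11.1 Prop. 12 and Prop. 14 (i)]
[cite: SerreTate1968, §1] -/
theorem geomReductionMap_geomPointsMap_of_homReduction (h : IsAbelianSchemeModel A v 𝒜) {S : B.GoodReductionAt v}
    (H : GoodReductionAt.HomReduction h.goodReductionAt S) (f : A ⟶ B) (x : A.geomPoints) :
    S.geomReductionMap (Hom.geomPointsMap f x) = Hom.geomPointsMap (H.redHom f) (h.specialFibreReductionHom x) := by
  rw [← h.geomReductionMap_goodReductionAt]
  exact H.geomReductionMap_geomPointsMap f x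

/-- The symmetric form, INTO a produced datum: for `H : HomReduction R h.goodReductionAt` (ANY source datum `R` of `A`),
`red_v (f x) = (H.redHom f) (red_R x)`. [cite: Shimura1998, §11.1 Prop. 12 and Prop. 14 (i)] [cite: SerreTate1968, §1] -/
theorem specialFibreReductionHom_geomPointsMap_of_homReduction (h : IsAbelianSchemeModel B v 𝒜)
    {R : A.GoodReductionAt v} (H : GoodReductionAt.HomReduction R h.goodReductionAt) (f : A ⟶ B) (x : A.geomPoints) :
    h.specialFibreReductionHom (Hom.geomPointsMap f x) = Hom.geomPointsMap (H.redHom f) (R.geomReductionMap x) := by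
  rw [← h.geomReductionMap_goodReductionAt]
  exact H.geomReductionMap_geomPointsMap f x

end IsAbelianSchemeModel

end Literature.NumberTheory.DiophantineGeometry

end
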